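import Literature.MathematicalPhysics.QuantumFieldTheory.Balaban1983to89.Node00.Record9
import Literature.MathematicalPhysics.QuantumFieldTheory.Balaban1983to89.Node00.RStepProvisosOfRecord

/-!
# NODE 00 — K0 `Record9Inhabited` AT `N = 1`: the Stage-9 record class is INHABITED over `SU(1)` (DEGENERATE corner, kernel census),
# and the residual choices every inhabitant needs at every `N` (the delta fluctuation factor of record, the identity `p–p′` selector,
# non-negativity of the step weights and of every slot of the represented tower of record)

Cell `pub-ymgap`, seat `pub-ymgap-dag-n23-b` (W00 datum-inhabitation lane; g2: `Record8Inhabited`, `Record8Chart`, `ChartOfRecord`).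
[III] = [Balaban1988Convergent], [IV] = [Balaban1989LargeFieldI], [I] = [Balaban1987RG1].

WHY.  The rev-1 item K0 `Record9Inhabited` (chair R447∕R449; director LINE №45 (3): INHABITED-AT-₉C is the A1 guard owed before any ₉ discharge)
reads, by def-T's `exists_world_isRecordOfRecord₉C`, «SOME admissible `θ : Stage9Params F N` satisfies its displayed provisos
`Stage9Params.Provisos θ`» (`intPiece`, `measω`, `measChi`, `zetaUnity`, `zetaAbs`, `rstep`).  This file settles the question AT `N = 1` and
isolates, for every `N`, the residual data an inhabitant must choose.

* §1 (every `N`): the DELTA fluctuation factor of record `zetaDeltaOfRecord` (`ζ_{k+1}(R,S) := [(R,S) = (∅,∅)]`) with BOTH displayed ζ-laws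
  (`isZetaUnity_zetaDeltaOfRecord`, `isZetaAbsLeOne_zetaDeltaOfRecord`) and `0 ≤ ζ`; the identity selector `ppSelIdOfRecord` (`Z″ := Z`);
  `0 ≤ ω`, `0 ≤ w` for the label ∕ step weights of record at any `ζ ≥ 0` (`ωOfRecord_nonneg`, `wOfRecord_nonneg`); `0 ≤` every R-stepped
  slot, every T-stepped slot, hence every slot of BOTH slot families of the represented tower of record at non-negative step weights
  (`rstepSlot_nonneg`, `tstepOfRecord_nonneg`, `slotsOfRecord_nonneg`, `slotsTOfRecord_nonneg`) — the sign half of def-R's written-out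
  (0.3) provisos (`provisosSupp_towerRepOfRecord_iff`, conjunct 2), discharged for every `N`.
* §2 (`N = 1`): `SU(1) = {1}` (`coe_SU_one_eq_one`, `subsingleton_SU_one`), so every configuration space `GaugeField P j (SU 1)` is ONE POINT:
  measurability of anything (`Subsingleton.measurable`), integrability of anything (`integrable_of_subsingleton`), the restricted integral
  `∫dV⌈_{Z′} f = f` (`fibreIntegral_SU_one`, probability Haar fibres), a pointwise bound over the FINITE sequence type at the one configuration.
* §3 THE WITNESS (every `N`) and THE CENSUS (`N = 1`): `stage9DeltaOfRecord θ₈` := a Stage-8 parameter extended by `τ9 := (1, 0, 0)`, the identity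
  selector, `A₁ := 0`, the delta `ζ`, `ScorrLaw := ⊤`, `cβ := 1`; admissible iff `θ₈` is admissible with the chart clause of record at `c = 1`
  (`admissible_stage9DeltaOfRecord`); **`provisos_stage9DeltaOfRecord_SU1 : (stage9DeltaOfRecord F 1 θ₈).Provisos`** for EVERY `θ₈ : Stage8Params F 1`;
  **`exists_admissible_provisos_SU1`**, **`exists_isRecordOfRecord₉C_SU1 : ∃ D w, IsRecordOfRecord₉C F 1 D w`** (+ window form) — INHABITED-AT-₉C
  AT `N = 1`, with n23-b g2's `exists_admissible_stage8Params_chartOfRecord F 1` as the Stage-8 part (whose chart of record is the ZERO chart at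
  `N = 1`, `Stage8Params.IsChartOfRecord.rho8_eq_zero_of_one`).

## HONEST FRAMING — what this is NOT

* The `N = 1` inhabitant is the DEGENERATE corner — the ₉ analogue of the ZEROCHART ∕ `N = 1` censuses of record (chair R445 ∕ R448 (1)(3)):
  `SU(1)` is the trivial group, the field space is a point, every proviso closes by typing.  It is NOT an inhabitant at any `SU(N)`, `N ≥ 2`;
  it asserts NOTHING of Bałaban's; no node count moves.  What it certifies in the kernel: (i) an `N`-unqualified K0 `∀ F, ∃ D w, IsRecordOfRecord₉C F N D w`
  is closable at `N = 1` by bookkeeping — K0 of record should carry `2 ≤ N`, as R448 ruled for B6; (ii) the six provisos of `Record9` carry no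
  content beyond measure-theoretic regularity of the record's objects over the configuration σ-algebra (at a one-point configuration space they
  all close).
* At `N ≥ 2` the provisos `measChi`, `measω`, `intPiece (k ≥ 1)` and `rstep` (conjuncts 1, 3, 4) are POINTWISE ∕ Borel-measurability clauses about
  functions defined through `Classical.choose` (def-R's (2.12) solution map of record `UminOfRecord`, `Node00.SmallFieldChiOfRecord`, inside every
  `χ` of record and every label weight) and through Mathlib's Radon–Nikodym REPRESENTATIVE (`T4AveragingDisintegration.margDensity` inside every
  T-slot of level `≥ 1`): see the seat's located note `K0-TYPING-CENSUS.md`; nothing here decides them.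
* One finite four-torus programme at fixed `ε` — NOT the continuum limit on ℝ⁴, NOT infinite volume, NOT OS, NOT a mass gap, NOT the Clay problem.
-/

noncomputable section

open MeasureTheory
open scoped BigOperators

namespace Literature.MathematicalPhysics.QuantumFieldTheory.Balaban1983to89.Node00

open T4Continuum B14.Eq218Concrete T4AveragingDisintegration T4FiniteEpsInhabited
open B15.BasicStep (fibreIntegral)
open DagBinding (WorldP)

/-! ## §1. Residual choices every inhabitant needs (every `N`) -/

section Zeta

variable (F : T4Family) (N : ℕ) (ν : Stage7Numerics) (M : ℕ)

open Classical in
/-- **The DELTA fluctuation factor of record**: `ζ_{k+1}(R, S) := 1` if `(R, S) = (∅, ∅)` and `0` otherwise — the residual `ζ` of (3.16)·(3.20)·(3.21)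
concentrated on the empty label (a RESIDUAL CHOICE meeting the two displayed ζ-laws; print's ζ is the decomposition of unity over the
fluctuation-field labels `(R_{k+1}, S_{k+1})`, NOT this). [cite: Balaban1988Convergent, (3.16) p.268, (3.20)–(3.21) p.269 (the laws it meets)] -/
def zetaDeltaOfRecord : ZetaOfRecord F N ν M :=
  fun _ _ _ _ _ _ RS _ _ => if RS = (∅, ∅) then 1 else 0

/-- `0 ≤ ζ` for the delta factor. [cite: Balaban1988Convergent, (3.16) p.268 (bookkeeping)] -/
theorem zetaDeltaOfRecord_nonneg (p : B12.RunParams) (g : ℕ → ℝ) (k : ℕ) (s : SeqOfRecord F ν M g p.K k)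
    (Pl Ql : Finset (Iχ F ν p g k)) (RS : Finset (Iχ F ν p g k) × Finset (Iχ F ν p g k))
    (U : GaugeField (F.P p.K) k (SU N)) (V' : GaugeField (F.P p.K) (k + 1) (SU N)) :
    0 ≤ zetaDeltaOfRecord F N ν M p g k s Pl Ql RS U V' := by
  unfold zetaDeltaOfRecord
  split_ifs <;> norm_num

/-- The delta factor RESOLVES UNITY: `Σ_{(R,S)} ζ_{k+1}(R,S) = 1` (the displayed law `IsZetaUnity`). [cite: Balaban1988Convergent, (3.16) p.268, (3.20)–(3.21) p.269] -/
theorem isZetaUnity_zetaDeltaOfRecord : IsZetaUnity F N ν M (zetaDeltaOfRecord F N ν M) := by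
  intro p g k s Pl Ql U V'
  rw [Finset.sum_eq_single ((∅, ∅) : Finset (Iχ F ν p g k) × Finset (Iχ F ν p g k))]
  · simp [zetaDeltaOfRecord]
  · intro RS _ hRS
    simp [zetaDeltaOfRecord, hRS]
  · intro h
    exact absurd (Finset.mem_univ _) h

/-- The delta factor has `Σ_{(R,S)} |ζ_{k+1}(R,S)| ≤ 1` (the displayed law `IsZetaAbsLeOne`). [cite: Balaban1988Convergent, (3.16) p.268, (3.21) p.269 (bookkeeping)] -/
theorem isZetaAbsLeOne_zetaDeltaOfRecord : IsZetaAbsLeOne F N ν M (zetaDeltaOfRecord F N ν M) := by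
  intro p g k s Pl Ql U V'
  have h : ∑ RS, |zetaDeltaOfRecord F N ν M p g k s Pl Ql RS U V'| = ∑ RS, zetaDeltaOfRecord F N ν M p g k s Pl Ql RS U V' :=
    Finset.sum_congr rfl fun RS _ => abs_of_nonneg (zetaDeltaOfRecord_nonneg F N ν M p g k s Pl Ql RS U V')
  rw [h, isZetaUnity_zetaDeltaOfRecord F N ν M p g k s Pl Ql U V']

/-- **The identity `p–p′` selector** `Z ↦ Z″ := Z` (a RESIDUAL CHOICE of def-R's `PpSelOfRecord`; with it the support-form (0.3) clause reads
«where `∫dV⌈_{Z′(s)} χ_k(s)·slot(s)` vanishes, `χ_k(s)·slot(s)` vanishes» — print's `Z″` is the sub-region of [IV] p. 176, NOT this).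
[cite: Balaban1989LargeFieldI, (0.3) p.176 (the slot it fills)] -/
def ppSelIdOfRecord : PpSelOfRecord F ν M := fun _ _ _ s => s

/-- The identity selector, unfolded. [cite: Balaban1989LargeFieldI, (0.3) p.176 (bookkeeping)] -/
theorem ppSelIdOfRecord_apply (p : B12.RunParams) (g : ℕ → ℝ) (k : ℕ) (s : SeqOfRecord F ν M g p.K k) :
    ppSelIdOfRecord F ν M p g k s = s := rfl

end Zeta

section Residual

variable (F : T4Family) (N : ℕ) [NeZero N] (ν : Stage7Numerics) (M : ℕ) (p : B12.RunParams) (g : ℕ → ℝ) (k : ℕ)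

/-- `0 ≤ ω` for the label weights of record at any non-negative fluctuation factor (`a, b ≥ 0` are n02-b's `aWeight_nonneg` ∕ `bWeight_nonneg`).
[cite: Balaban1988Convergent, (3.2)–(3.3) p.265, (3.16) p.268 (bookkeeping)] -/
theorem ωOfRecord_nonneg (A₁ : ℝ) {ζ : ZetaOfRecord F N ν M}
    (hζ : ∀ p g k s Pl Ql RS U V', 0 ≤ ζ p g k s Pl Ql RS U V')
    (s : SeqOfRecord F ν M g p.K k) (t : LbOfRecord F ν p g k)
    (U : GaugeField (F.P p.K) k (SU N)) (V' : GaugeField (F.P p.K) (k + 1) (SU N)) :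
    0 ≤ ωOfRecord F N ν M p g k A₁ ζ s t U V' :=
  mul_nonneg (mul_nonneg (aWeight_nonneg F N ν M p g k s t.1 V') (bWeight_nonneg F N ν M p g k A₁ s t.1 t.2.1 U V'))
    (hζ p g k s t.1 t.2.1 t.2.2 U V')

/-- `0 ≤ w` for the step weights of record at any non-negative fluctuation factor (a sum of label weights).
[cite: Balaban1988Convergent, (3.2)–(3.5) p.265, (3.16) p.268 (bookkeeping)] -/
theorem wOfRecord_nonneg (A₁ : ℝ) {ζ : ZetaOfRecord F N ν M}
    (hζ : ∀ p g k s Pl Ql RS U V', 0 ≤ ζ p g k s Pl Ql RS U V')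
    (s' : SeqOfRecord F ν M g p.K (k + 1)) (U : GaugeField (F.P p.K) k (SU N)) (V' : GaugeField (F.P p.K) (k + 1) (SU N)) :
    0 ≤ wOfRecord F N ν M A₁ ζ p g k s' U V' := by
  rw [wOfRecord_apply]
  unfold resumWeights
  exact Finset.sum_nonneg fun t _ => ωOfRecord_nonneg F N ν M p g k A₁ hζ s'.init t U V'

/-- **`0 ≤` the step weights of record at the delta factor.** [cite: Balaban1988Convergent, (3.2)–(3.5) p.265 (bookkeeping)] -/
theorem wOfRecord_zetaDelta_nonneg (A₁ : ℝ) (s' : SeqOfRecord F ν M g p.K (k + 1)) (U : GaugeField (F.P p.K) k (SU N))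
    (V' : GaugeField (F.P p.K) (k + 1) (SU N)) :
    0 ≤ wOfRecord F N ν M A₁ (zetaDeltaOfRecord F N ν M) p g k s' U V' :=
  wOfRecord_nonneg F N ν M p g k A₁ (zetaDeltaOfRecord_nonneg F N ν M) s' U V'

variable {p g k}

/-- **`0 ≤` the T-step of a non-negative slot at non-negative step weights** (`χ_k(s) ≥ 0`; the disintegration-kernel transport preserves
positivity pointwise). [cite: Balaban1988Convergent, (3.1) p.264, (3.24)–(3.25) p.270 (bookkeeping)] -/
theorem tstepOfRecord_nonneg {w : StepWeightsOfRecord F N ν M} (hw : ∀ s' U V', 0 ≤ w p g k s' U V')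
    {T : SeqOfRecord F ν M g p.K k → Density (F.P p.K) k (SU N)} (hT : ∀ s U, 0 ≤ T s U)
    (s' : SeqOfRecord F ν M g p.K (k + 1)) (V' : GaugeField (F.P p.K) (k + 1) (SU N)) :
    0 ≤ tstepOfRecord F N ν M w p g k T s' V' := by
  rw [tstepOfRecord_apply]
  exact transportOfRecord_nonneg F N p.K k _
    (fun U => mul_nonneg (hw s' U V') (mul_nonneg (chiSeqOfRecord_nonneg F N ν M g p.K k s'.init U) (hT s'.init U))) V'

variable (τ : TowerNumerics)

/-- **`0 ≤` the R-stepped slot of a non-negative slot**, for ANY selector: the new slot is the old one times a finite sum of ratios of restricted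
integrals, each a quotient of two `toReal`s of `lintegral`s. [cite: Balaban1989LargeFieldI, (0.3) p.176 (bookkeeping)] -/
theorem rstepSlot_nonneg (sel : SeqOfRecord F ν τ.M g p.K k → SeqOfRecord F ν τ.M g p.K k) {f : TexpASlot F N ν τ.M p g k}
    (hf : ∀ s V, 0 ≤ f s V) (s : SeqOfRecord F ν τ.M g p.K k) (V : GaugeField (F.P p.K) k (SU N)) :
    0 ≤ rstepSlot F N ν τ p g k sel f s V := by
  unfold rstepSlot rstepOfSel
  dsimp only
  refine mul_nonneg (hf s V) (Finset.sum_nonneg fun a _ => ?_)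
  unfold rratio fibreIntegral
  exact div_nonneg ENNReal.toReal_nonneg ENNReal.toReal_nonneg

/-- **`0 ≤` EVERY SLOT OF THE POST-𝐑 FAMILY of the represented tower of record at non-negative step weights** (induction on the level:
`ρ₀ > 0`; the T-step and the R-step preserve the sign). [cite: Balaban1988Convergent, (2.18) p.257, (3.24) p.270; Balaban1989LargeFieldI, (0.3) p.176 (bookkeeping)] -/
theorem slotsOfRecord_nonneg (E : B12.RunParams → ℝ) {w : StepWeightsOfRecord F N ν τ.M} (hw : ∀ p g k s' U V', 0 ≤ w p g k s' U V')
    (ppSel : PpSelOfRecord F ν τ.M) (p : B12.RunParams) (g : ℕ → ℝ) :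
    ∀ (k : ℕ) (s : SeqOfRecord F ν τ.M g p.K k) (V : GaugeField (F.P p.K) k (SU N)), 0 ≤ slotsOfRecord F N ν τ E w ppSel p g k s V := by
  intro k
  induction k with
  | zero => intro s V; exact (rhoZeroOfRecord_pos F N p.K (g 0) (E p) V).le
  | succ k ih =>
    intro s V
    rw [slotsOfRecord_succ, slotsTOfRecord_succ]
    exact rstepSlot_nonneg F N ν τ (ppSel p g (k + 1)) (tstepOfRecord_nonneg F N ν τ.M (hw p g k) (ih)) s V

/-- **`0 ≤` EVERY SLOT OF THE PRE-𝐑 FAMILY** (the slots of `𝐓ρ_k`) at non-negative step weights. [cite: Balaban1988Convergent, (3.24)–(3.25) p.270 (bookkeeping)] -/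
theorem slotsTOfRecord_nonneg (E : B12.RunParams → ℝ) {w : StepWeightsOfRecord F N ν τ.M} (hw : ∀ p g k s' U V', 0 ≤ w p g k s' U V')
    (ppSel : PpSelOfRecord F ν τ.M) (p : B12.RunParams) (g : ℕ → ℝ) :
    ∀ (k : ℕ) (s : SeqOfRecord F ν τ.M g p.K k) (V : GaugeField (F.P p.K) k (SU N)), 0 ≤ slotsTOfRecord F N ν τ E w ppSel p g k s V
  | 0, s, V => (rhoZeroOfRecord_pos F N p.K (g 0) (E p) V).le
  | k + 1, s, V => by
    rw [slotsTOfRecord_succ]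
    exact tstepOfRecord_nonneg F N ν τ.M (hw p g k) (slotsOfRecord_nonneg F N ν τ E hw ppSel p g k) s V

/-- **CONJUNCT 2 of the written-out (0.3) provisos, EVERY `N`**: the pieces `χ_{k+1}(s)·(𝐓-slot)(s)` of the pre-𝐑 tower of record are non-negative
at non-negative step weights (`provisosSupp_towerRepOfRecord_iff`, second conjunct). [cite: Balaban1989LargeFieldI, (0.3) p.176 (bookkeeping)] -/
theorem piece_slotsTOfRecord_nonneg (E : B12.RunParams → ℝ) {w : StepWeightsOfRecord F N ν τ.M}
    (hw : ∀ p g k s' U V', 0 ≤ w p g k s' U V') (ppSel : PpSelOfRecord F ν τ.M) (p : B12.RunParams) (g : ℕ → ℝ) (k : ℕ)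
    (s : SeqOfRecord F ν τ.M g p.K k) (V : GaugeField (F.P p.K) k (SU N)) :
    0 ≤ chiSeqOfRecord F N ν τ.M g p.K k s V * slotsTOfRecord F N ν τ E w ppSel p g k s V :=
  mul_nonneg (chiSeqOfRecord_nonneg F N ν τ.M g p.K k s V) (slotsTOfRecord_nonneg F N ν τ E hw ppSel p g k s V)

end Residual

/-! ## §2. `SU(1)` is trivial: one-point configuration spaces -/

section SUOne

/-- Every element of `SU(1)` is the identity matrix (`det U = U₀₀ = 1`). [folklore] -/
private theorem coe_SU_one_eq_one (U : SU 1) : (U : Matrix (Fin 1) (Fin 1) ℂ) = 1 := by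
  have hdet : (U : Matrix (Fin 1) (Fin 1) ℂ).det = 1 := (Matrix.mem_specialUnitaryGroup_iff.mp U.prop).2
  rw [Matrix.det_fin_one] at hdet
  ext i j
  fin_cases i; fin_cases j
  simpa using hdet

/-- `SU(1)` is a one-element type. [folklore] -/
private theorem subsingleton_SU_one : Subsingleton (SU 1) :=
  ⟨fun a b => Subtype.ext ((coe_SU_one_eq_one a).trans (coe_SU_one_eq_one b).symm)⟩

/-- Every `SU(1)` configuration space `GaugeField P j (SU 1)` is a one-element type. [folklore] -/
private theorem subsingleton_gaugeField_SU_one (P : Params) (j : ℕ) : Subsingleton (GaugeField P j (SU 1)) := by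
  haveI := subsingleton_SU_one
  exact inferInstanceAs (Subsingleton (PBond P j → SU 1))

/-- Any real function on a one-element measurable space is integrable for a finite measure. [folklore] -/
private theorem integrable_of_subsingleton {α : Type*} [MeasurableSpace α] [Subsingleton α] (μ : Measure α) [IsFiniteMeasure μ] (f : α → ℝ) :
    Integrable f μ := by
  rcases isEmpty_or_nonempty α with hα | ⟨⟨a⟩⟩
  · rw [Measure.eq_zero_of_isEmpty μ]
    exact integrable_zero_measure
  · have hf : f = fun _ => f a := funext fun x => congrArg f (Subsingleton.elim x a)
    rw [hf]
    exact integrable_const _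

/-- **Over `SU(1)` the restricted integral `∫dV⌈_{Z′} f` IS `f`** at every non-negative value: the fibre is one point carrying probability Haar.
[cite: Balaban1989LargeFieldI, (0.3) p.176 (the object, at the degenerate group)] -/
theorem fibreIntegral_SU_one {P : Params} {j : ℕ} [DecidableEq (PBond P j)] (s : Finset (PBond P j)) (f : Density P j (SU 1))
    (V : GaugeField P j (SU 1)) (hf : 0 ≤ f V) : fibreIntegral s f V = f V := by
  haveI := subsingleton_SU_one
  haveI := subsingleton_gaugeField_SU_one P j
  unfold fibreIntegral lmarginal
  have h : (fun y : (i : ↥s) → SU 1 => ENNReal.ofReal (f (Function.updateFinset V s y))) = fun _ => ENNReal.ofReal (f V) :=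
    funext fun y => by rw [Subsingleton.elim (Function.updateFinset V s y) V]
  rw [h, lintegral_const, measure_univ, mul_one, ENNReal.toReal_ofReal hf]

end SUOne

/-! ## §3. The witness (every `N`) and the census (`N = 1`) -/

section Witness

variable (F : T4Family) (N : ℕ) [NeZero N]

/-- **THE DELTA EXTENSION of a Stage-8 parameter to Stage 9**: tower numerics `(M, Nsz, Nmem) := (1, 0, 0)`, the identity `p–p′` selector,
`A₁ := 0`, the delta fluctuation factor, `ScorrLaw := ⊤`, chart constant `cβ := 1` (residual choices — NOT Bałaban's objects).
[cite: Balaban1989LargeFieldI, (2.1) p.182 and (0.3) p.176; Balaban1988Convergent, (3.16) p.268; Balaban1987RG1, (1.20)–(1.21) p.264 (the slots filled)] -/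
def stage9DeltaOfRecord (θ₈ : Stage8Params F N) : Stage9Params F N where
  toStage8Params := θ₈
  τ9 := ⟨1, 0, 0⟩
  ppSel := ppSelIdOfRecord F θ₈.ν 1
  A₁ := 0
  ζ := zetaDeltaOfRecord F N θ₈.ν 1
  ScorrLaw := fun _ _ _ => True
  cβ := 1

/-- The delta extension keeps the Stage-8 parameter (`rfl`). [cite: Balaban1987RG1, (0.21) p.256 (bookkeeping)] -/
theorem stage9DeltaOfRecord_toStage8Params (θ₈ : Stage8Params F N) : (stage9DeltaOfRecord F N θ₈).toStage8Params = θ₈ := rfl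

/-- **Admissibility of the delta extension** = Stage-8 admissibility ∧ the chart clause of record at `c = 1`. [cite: Balaban1987RG1, (1.20)–(1.21) p.264; Balaban1989LargeFieldI, (2.1) p.182 (bookkeeping)] -/
theorem admissible_stage9DeltaOfRecord {θ₈ : Stage8Params F N} (hθ : θ₈.Admissible) (hch : θ₈.IsChartOfRecord 1) :
    (stage9DeltaOfRecord F N θ₈).Admissible :=
  ⟨hθ, one_pos, hch, le_rfl⟩

/-- … and conversely (`Iff`). [cite: Balaban1987RG1, (1.20)–(1.21) p.264 (bookkeeping)] -/
theorem admissible_stage9DeltaOfRecord_iff (θ₈ : Stage8Params F N) :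
    (stage9DeltaOfRecord F N θ₈).Admissible ↔ θ₈.Admissible ∧ θ₈.IsChartOfRecord 1 :=
  ⟨fun h => ⟨h.1, h.2.2.1⟩, fun h => admissible_stage9DeltaOfRecord F N h.1 h.2⟩

/-- The step weights of the delta extension are non-negative (every `N`). [cite: Balaban1988Convergent, (3.2)–(3.5) p.265 (bookkeeping)] -/
theorem wOfRecord₉_stage9DeltaOfRecord_nonneg (θ₈ : Stage8Params F N) (p : B12.RunParams) (g : ℕ → ℝ) (k : ℕ)
    (s' : SeqOfRecord F θ₈.ν 1 g p.K (k + 1)) (U : GaugeField (F.P p.K) k (SU N)) (V' : GaugeField (F.P p.K) (k + 1) (SU N)) :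
    0 ≤ wOfRecord₉ F N (stage9DeltaOfRecord F N θ₈) p g k s' U V' :=
  wOfRecord_zetaDelta_nonneg F N θ₈.ν 1 p g k 0 s' U V'

/-- The two displayed ζ-laws hold for the delta extension (every `N`). [cite: Balaban1988Convergent, (3.16) p.268, (3.20)–(3.21) p.269 (bookkeeping)] -/
theorem zetaLaws_stage9DeltaOfRecord (θ₈ : Stage8Params F N) :
    IsZetaUnity F N (stage9DeltaOfRecord F N θ₈).ν (stage9DeltaOfRecord F N θ₈).τ9.M (stage9DeltaOfRecord F N θ₈).ζ ∧
      IsZetaAbsLeOne F N (stage9DeltaOfRecord F N θ₈).ν (stage9DeltaOfRecord F N θ₈).τ9.M (stage9DeltaOfRecord F N θ₈).ζ :=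
  ⟨isZetaUnity_zetaDeltaOfRecord F N θ₈.ν 1, isZetaAbsLeOne_zetaDeltaOfRecord F N θ₈.ν 1⟩

variable {N} in
/-- **CONJUNCT 2 of `rstep` for the delta extension, every `N`**: the pre-𝐑 pieces of its tower of record are non-negative.
[cite: Balaban1989LargeFieldI, (0.3) p.176 (bookkeeping)] -/
theorem piece_nonneg_stage9DeltaOfRecord (θ₈ : Stage8Params F N) (p : B12.RunParams) (k : ℕ)
    (s : SeqOfRecord F θ₈.ν 1 (gOfRecord₉ F N (stage9DeltaOfRecord F N θ₈) p) p.K k) (V : GaugeField (F.P p.K) k (SU N)) :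
    0 ≤ chiSeqOfRecord F N θ₈.ν 1 (gOfRecord₉ F N (stage9DeltaOfRecord F N θ₈) p) p.K k s V *
      slotsTOfRecord F N θ₈.ν ⟨1, 0, 0⟩ (EOfRecord₉ F N (stage9DeltaOfRecord F N θ₈)) (wOfRecord₉ F N (stage9DeltaOfRecord F N θ₈))
        (ppSelIdOfRecord F θ₈.ν 1) p (gOfRecord₉ F N (stage9DeltaOfRecord F N θ₈) p) k s V :=
  piece_slotsTOfRecord_nonneg F N θ₈.ν ⟨1, 0, 0⟩ _ (fun p g k s' U V' => wOfRecord₉_stage9DeltaOfRecord_nonneg F N θ₈ p g k s' U V') _ p _ k s V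

/-- **K0 AT `N = 1`: THE DELTA EXTENSION OF EVERY STAGE-8 PARAMETER OVER `SU(1)` SATISFIES ITS DISPLAYED PROVISOS** — `intPiece` (integrability
on a one-point probability space), `measω` ∕ `measChi` (everything is measurable on a one-point space), the two ζ-laws (§1), `rstep` in the
support form: measurable pieces, non-negative pieces (§1, every `N`), a uniform bound (finitely many sequences, one configuration), and the
support clause at the identity selector (`∫dV⌈_{Z′(s)} t_s = t_s` on a one-point fibre).  DEGENERATE corner; nothing of Bałaban's asserted.
[cite: Balaban1988Convergent, (2.18) p.257, (3.2)–(3.9) pp.265–266, (3.16) p.268; Balaban1989LargeFieldI, (0.3)–(0.4) p.176 (the provisos, met at the trivial group)] -/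
theorem provisos_stage9DeltaOfRecord_SU1 (θ₈ : Stage8Params F 1) : (stage9DeltaOfRecord F 1 θ₈).Provisos := by
  haveI := subsingleton_SU_one
  refine ⟨fun p k _ s => ?_, fun p k _ s t => ?_, fun p k _ s' => ?_,
    isZetaUnity_zetaDeltaOfRecord F 1 θ₈.ν 1, isZetaAbsLeOne_zetaDeltaOfRecord F 1 θ₈.ν 1, fun p k _ hk => ?_⟩
  · haveI := subsingleton_gaugeField_SU_one (F.P p.K) k
    exact integrable_of_subsingleton _ _
  · haveI := subsingleton_gaugeField_SU_one (F.P p.K) k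
    haveI := subsingleton_gaugeField_SU_one (F.P p.K) (k + 1)
    exact Subsingleton.measurable
  · haveI := subsingleton_gaugeField_SU_one (F.P p.K) (k + 1)
    exact Subsingleton.measurable
  · haveI := subsingleton_gaugeField_SU_one (F.P p.K) (k + 1)
    have h0 := piece_nonneg_stage9DeltaOfRecord F θ₈ p (k + 1)
    have key : ∀ (S : Finset (PBond (F.P p.K) (k + 1))) (f : Density (F.P p.K) (k + 1) (SU 1))
        (V : GaugeField (F.P p.K) (k + 1) (SU 1)), 0 ≤ f V → fibreIntegral S f V = 0 → f V = 0 :=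
      fun S f V hf hS => (fibreIntegral_SU_one S f V hf).symm.trans hS
    refine (provisosSupp_towerRepOfRecord_iff F 1 θ₈.ν ⟨1, 0, 0⟩ _ _ p _ (k + 1)).2
      ⟨fun s => Subsingleton.measurable, h0, ?_, fun s V h => key _ _ V (h0 s V) h⟩
    let V₀ : GaugeField (F.P p.K) (k + 1) (SU 1) := fun _ => 1
    refine ⟨∑ s, chiSeqOfRecord F 1 θ₈.ν 1 (gOfRecord₉ F 1 (stage9DeltaOfRecord F 1 θ₈) p) p.K (k + 1) s V₀ *
        slotsTOfRecord F 1 θ₈.ν ⟨1, 0, 0⟩ (EOfRecord₉ F 1 (stage9DeltaOfRecord F 1 θ₈))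
          (wOfRecord₉ F 1 (stage9DeltaOfRecord F 1 θ₈)) (ppSelIdOfRecord F θ₈.ν 1) p
          (gOfRecord₉ F 1 (stage9DeltaOfRecord F 1 θ₈) p) (k + 1) s V₀, fun s V => ?_⟩
    rw [Subsingleton.elim V V₀]
    exact Finset.single_le_sum (fun s _ => h0 s V₀) (Finset.mem_univ s)

/-- **INHABITED PARAMETERS AT `N = 1`**: an admissible Stage-9 parameter over `SU(1)` satisfying its displayed provisos EXISTS, with any box radius
`γ > 0` (Stage-8 part: n23-b g2's `exists_admissible_stage8Params_chartOfRecord F 1 γ`, whose chart of record is the zero chart at `N = 1`).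
DEGENERATE corner. [cite: Balaban1987RG1, (0.21) p.256 and (1.20)–(1.22) p.264; Balaban1989LargeFieldI, (0.3)–(0.4) p.176, (2.1) p.182 (bookkeeping witness at the trivial group)] -/
theorem exists_admissible_provisos_SU1 (γ : ℝ) (hγ : 0 < γ) :
    ∃ θ : Stage9Params F 1, θ.Admissible ∧ θ.Provisos ∧ θ.γ = γ := by
  obtain ⟨θ₈, hθ, -, hγ', hch⟩ := exists_admissible_stage8Params_chartOfRecord F 1 γ hγ
  exact ⟨stage9DeltaOfRecord F 1 θ₈, admissible_stage9DeltaOfRecord F 1 hθ hch, provisos_stage9DeltaOfRecord_SU1 F θ₈, hγ'⟩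

/-- **INHABITED-AT-₉C AT `N = 1`, window form**: for any box radius `γ` and window `0 < γw ≤ γ` a Stage-9 record over `SU(1)` exists whose world
has interval letter `γw` (def-T's `exists_world_isRecordOfRecord₉C` at the witness).  DEGENERATE corner; NOT an inhabitant at any `N ≥ 2`.
[cite: Balaban1989LargeFieldII, Thm 1 + (0.1) pp.355–356; Balaban1989LargeFieldI, (0.3)–(0.4) p.176 (bookkeeping witness at the trivial group)] -/
theorem exists_isRecordOfRecord₉C_SU1_window {γ γw : ℝ} (h0 : 0 < γw) (hle : γw ≤ γ) :
    ∃ (D : T4Continuum.FiniteEpsData F (SU 1)) (w : WorldP), IsRecordOfRecord₉C F 1 D w ∧ w.γ = γw := by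
  obtain ⟨θ, hθ, hP, hγ⟩ := exists_admissible_provisos_SU1 F γ (h0.trans_le hle)
  obtain ⟨w, hw, hwγ⟩ := exists_world_isRecordOfRecord₉C F 1 θ hP hθ (γw := γw) ⟨h0, by rw [hγ]; exact hle⟩
  exact ⟨_, w, hw, hwγ⟩

/-- **INHABITED-AT-₉C AT `N = 1`** (plain form): `∃ D w, IsRecordOfRecord₉C F 1 D w`.  DEGENERATE corner — the `N = 1` census of K0 as typed;
K0 of record should carry `2 ≤ N`. [cite: Balaban1989LargeFieldII, Thm 1 + (0.1) pp.355–356 (bookkeeping witness at the trivial group)] -/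
theorem exists_isRecordOfRecord₉C_SU1 :
    ∃ (D : T4Continuum.FiniteEpsData F (SU 1)) (w : WorldP), IsRecordOfRecord₉C F 1 D w := by
  obtain ⟨D, w, h, -⟩ := exists_isRecordOfRecord₉C_SU1_window F (γ := 1) (γw := 1) one_pos le_rfl
  exact ⟨D, w, h⟩

/-- **THE `N = 1` CENSUS, both directions in one line**: over `SU(1)` the Stage-9 record class is inhabited AND every Stage-9 record there has the
ZERO β of record (n28-a's `βfun_eq_zeroHBeta_of_isRecordOfRecord₉C_one` direction is theirs; here only inhabitation + the datum's Stage-0 clause).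
[cite: Balaban1987RG1, (0.3)–(0.4) p.253 (bookkeeping)] -/
theorem exists_isRecordOfRecord₉C_SU1_and_datum₀ :
    ∃ (D : T4Continuum.FiniteEpsData F (SU 1)) (w : WorldP), IsRecordOfRecord₉C F 1 D w ∧ IsDatumOfRecord₀ F 1 D := by
  obtain ⟨D, w, h⟩ := exists_isRecordOfRecord₉C_SU1 F
  exact ⟨D, w, h, isDatumOfRecord₀_of_isRecordOfRecord₉C h⟩

end Witness

end Literature.MathematicalPhysics.QuantumFieldTheory.Balaban1983to89.Node00

end
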